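import Literature.NumberTheory.Automorphic.UnitaryGroupTraceZeroLine
import Literature.NumberTheory.Automorphic.IdeleModuleProofs
import HarnessLib

/-!
# The line dictionary `θ : 𝔸_F ≃ 𝔸_E⁻`: Haar measures and the module `traceZeroModulus (a ⊗ 1) = ‖a‖_{𝔸_F}`

Topic `NumberTheory/Automorphic`; namespace `Literature.NumberTheory.Automorphic.UnitaryGroup`.
THEOREMS ONLY (no definition, no instance, no notation, no named fact, no `sorry`); sequel of
★ `UnitaryGroupTraceZeroLine` (`traceZeroLine F E c hcδ hδ : 𝔸_F ≃ₜ+ 𝔸_E⁻`, `t ↦ (t ⊗ 1) · δ`, for a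
quadratic extension `E/F` of number fields with involution `c` and `c δ = -δ ≠ 0`).

* §4 Haar measures: `θ_* μ_F` is an additive Haar measure on `𝔸_E⁻` (and `θ⁻¹_* μ⁻` one on `𝔸_F`),
  `θ` is measure preserving, change of variables `∫ G d(θ_* μ) = ∫ G ∘ θ dμ` (Bochner and Lebesgue);
* §5 the MODULE DICTIONARY **`traceZeroModulus (a ⊗ 1) = ‖a‖_{𝔸_F}`** for every idele `a` of `F`
  (★ `traceZeroModulus` of `UnitaryGroupHeisenbergHaar` = Mathlib's `addEquivAddHaarChar` of the scaling
  `smulTraceZero (a ⊗ 1)`; transported along `θ ∘ (a ·) = (a ⊗ 1) ∘ θ` to Tate's Lemma 4.1.2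
  ★ `AdeleRing.addHaar_smul_eq_ideleNorm_mul` on `𝔸_F`), and, with the quadratic Galois descent of the
  first file, for every `c`-fixed idele of `E` (`exists_traceZeroModulus_eq_ideleNorm`).

In Rogawski's computation of the singular semisimple term [Rogawski1990, §7.2 (7.2.3)] this is the
identity `|α₃(m)|_F =` the module of `m` acting on the centre line `F δ₀ ⊗ 𝔸_F = 𝔸_E⁻`, which turns the
torus integral into Tate's zeta integral over `F^*∖I_F` (★ `TateTruncatedZetaIntegral*`, Lemma 7.1.1
with `K := F`).

Cell `hodgecm-mathlib`, ENGINE T1 LAW 5 (L5-iii-c) piece (c2). HC_CM is proved only modulo the 7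
printed citations until rung 0 closes — nothing here bears on a summit statement.

## References
* [CasselsFrohlichANT1967] J. W. S. Cassels, A. Fröhlich (eds.), *Algebraic Number Theory* (1967),
  Ch. II (Cassels) §14; Ch. XV (Tate) §4.1, Lemma 4.1.2.
* [Rogawski1990] J. D. Rogawski, *Automorphic Representations of Unitary Groups in Three Variables*,
  Ann. of Math. Stud. 123 (1990), §1.10, §7.2 (7.2.3).
-/

set_option autoImplicit false

noncomputable section

open NumberField IsDedekindDomain Topology MeasureTheory Measure Set
open scoped Pointwise NNReal ENNReal

namespace Literature.NumberTheory.Automorphic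

namespace UnitaryGroup

variable {F : Type} (E : Type) [Field F] [NumberField F] [Field E] [NumberField E] [Algebra F E]
  (c : E ≃ₐ[F] E) {δ : E}

/-! ## §4 Haar measures along the line -/

section Haar

variable [Algebra.IsQuadraticExtension F E] (hcδ : c δ = -δ) (hδ : δ ≠ 0)
  [MeasurableSpace (AdeleRing (𝓞 F) F)] [BorelSpace (AdeleRing (𝓞 F) F)]
  [MeasurableSpace (AdeleRing (𝓞 E) E)] [BorelSpace (AdeleRing (𝓞 E) E)]

/-- `θ` is measurable (a homeomorphism). [cite: CasselsFrohlichANT1967, Ch. II §14] -/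
theorem measurable_traceZeroLine : Measurable (traceZeroLine F E c hcδ hδ) :=
  (traceZeroLine F E c hcδ hδ).continuous.measurable

/-- **`θ_* μ_F` is an additive Haar measure on `𝔸_E⁻`** for every additive Haar measure `μ_F` on `𝔸_F`
(a topological-group isomorphism transports Haar measures). [cite: CasselsFrohlichANT1967, Ch. II §14] -/
theorem isAddHaarMeasure_map_traceZeroLine (μ : Measure (AdeleRing (𝓞 F) F)) [μ.IsAddHaarMeasure] :
    (μ.map (traceZeroLine F E c hcδ hδ)).IsAddHaarMeasure :=
  (traceZeroLine F E c hcδ hδ).isAddHaarMeasure_map μ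

/-- Conversely `θ⁻¹_* μ⁻` is an additive Haar measure on `𝔸_F` for every additive Haar measure `μ⁻` on
`𝔸_E⁻`. [cite: CasselsFrohlichANT1967, Ch. II §14] -/
theorem isAddHaarMeasure_map_traceZeroLine_symm (ν : Measure (traceZeroAdele F E c)) [ν.IsAddHaarMeasure] :
    (ν.map (traceZeroLine F E c hcδ hδ).symm).IsAddHaarMeasure :=
  (traceZeroLine F E c hcδ hδ).symm.isAddHaarMeasure_map ν

/-- `θ` is measure preserving from `μ` to `θ_* μ`. [cite: CasselsFrohlichANT1967, Ch. II §14] -/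
theorem measurePreserving_traceZeroLine (μ : Measure (AdeleRing (𝓞 F) F)) :
    MeasurePreserving (traceZeroLine F E c hcδ hδ) μ (μ.map (traceZeroLine F E c hcδ hδ)) :=
  ⟨measurable_traceZeroLine E c hcδ hδ, rfl⟩

/-- **Change of variables along the line** (Bochner): `∫ G d(θ_* μ) = ∫ G ∘ θ dμ`.
[cite: CasselsFrohlichANT1967, Ch. II §14] -/
theorem integral_map_traceZeroLine {V : Type*} [NormedAddCommGroup V] [NormedSpace ℝ V]
    (μ : Measure (AdeleRing (𝓞 F) F)) (G : traceZeroAdele F E c → V) :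
    ∫ y, G y ∂(μ.map (traceZeroLine F E c hcδ hδ)) = ∫ t, G (traceZeroLine F E c hcδ hδ t) ∂μ :=
  integral_map_equiv (traceZeroLine F E c hcδ hδ).toHomeomorph.toMeasurableEquiv G

/-- Change of variables along the line (Lebesgue): `∫⁻ G d(θ_* μ) = ∫⁻ G ∘ θ dμ`.
[cite: CasselsFrohlichANT1967, Ch. II §14] -/
theorem lintegral_map_traceZeroLine (μ : Measure (AdeleRing (𝓞 F) F)) (G : traceZeroAdele F E c → ℝ≥0∞) :
    ∫⁻ y, G y ∂(μ.map (traceZeroLine F E c hcδ hδ)) = ∫⁻ t, G (traceZeroLine F E c hcδ hδ t) ∂μ :=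
  lintegral_map_equiv G (traceZeroLine F E c hcδ hδ).toHomeomorph.toMeasurableEquiv

/-- `(θ_* μ)(X) = μ(θ⁻¹ X)` for every set `X` (`θ` is a measurable equivalence). [cite: CasselsFrohlichANT1967, Ch. II §14] -/
theorem map_traceZeroLine_apply (μ : Measure (AdeleRing (𝓞 F) F)) (X : Set (traceZeroAdele F E c)) :
    μ.map (traceZeroLine F E c hcδ hδ) X = μ (traceZeroLine F E c hcδ hδ ⁻¹' X) :=
  (traceZeroLine F E c hcδ hδ).toHomeomorph.toMeasurableEquiv.map_apply X

end Haar

/-! ## §5 The module dictionary `traceZeroModulus (a ⊗ 1) = ‖a‖_{𝔸_F}` -/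

section Modulus

variable [Algebra.IsQuadraticExtension F E] (hcδ : c δ = -δ) (hδ : δ ≠ 0)
  [LocallyCompactSpace (AdeleRing (𝓞 F) F)] [LocallyCompactSpace (AdeleRing (𝓞 E) E)]
  [MeasurableSpace (AdeleRing (𝓞 F) F)] [BorelSpace (AdeleRing (𝓞 F) F)]
  [MeasurableSpace (AdeleRing (𝓞 E) E)] [BorelSpace (AdeleRing (𝓞 E) E)]

omit [LocallyCompactSpace (AdeleRing (𝓞 F) F)] [LocallyCompactSpace (AdeleRing (𝓞 E) E)]
  [MeasurableSpace (AdeleRing (𝓞 F) F)] [BorelSpace (AdeleRing (𝓞 F) F)] [MeasurableSpace (AdeleRing (𝓞 E) E)]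
  [BorelSpace (AdeleRing (𝓞 E) E)] in
/-- Preimages along the dictionary: `θ⁻¹((a ⊗ 1)⁻¹ • X) = a⁻¹ • θ⁻¹(X)`, i.e.
`(smulTraceZero (a ⊗ 1) ∘ θ)⁻¹ X = (a ·)⁻¹ (θ⁻¹ X)` (plumbing). [folklore] -/
private theorem preimage_traceZeroLine_preimage_smulTraceZero (a : (AdeleRing (𝓞 F) F)ˣ) (X : Set (traceZeroAdele F E c)) :
    traceZeroLine F E c hcδ hδ ⁻¹'
        (smulTraceZero (AdeleRing.ideleBaseChange F E a) (conjAdele_ideleBaseChange E c a) ⁻¹' X) =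
      a⁻¹ • (traceZeroLine F E c hcδ hδ ⁻¹' X) := by
  rw [← Set.preimage_comp, ← traceZeroLine_comp_mul_left E c hcδ hδ a, Set.preimage_comp,
    ← Set.preimage_smul_inv, inv_inv]
  rfl

include hcδ hδ in
/-- **The module dictionary**: for an idele `a` of `F`, the module of the scaling of `𝔸_E⁻` by the
`c`-fixed idele `a ⊗ 1` is the idelic norm of `a`: `traceZeroModulus (a ⊗ 1) = ‖a‖_{𝔸_F}` (transport a
Haar measure of `𝔸_F` along `θ`, `θ ∘ (a ·) = (a ⊗ 1) ∘ θ`, and Tate's Lemma 4.1.2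
★ `AdeleRing.addHaar_smul_eq_ideleNorm_mul` on `𝔸_F`). With §2's descent every `c`-fixed idele scaling of
`𝔸_E⁻` has module an idelic norm of `F`. [cite: CasselsFrohlichANT1967, Ch. XV Lemma 4.1.2] -/
theorem traceZeroModulus_ideleBaseChange (a : (AdeleRing (𝓞 F) F)ˣ) :
    traceZeroModulus (AdeleRing.ideleBaseChange F E a) (conjAdele_ideleBaseChange E c a) =
      IdeleClassGroup.ideleNorm F a := by
  haveI := locallyCompactSpace_traceZeroAdele (F := F) (E := E) (c := c)
  set θ := traceZeroLine F E c hcδ hδ with hθ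
  set φ := smulTraceZero (AdeleRing.ideleBaseChange F E a) (conjAdele_ideleBaseChange E c a) with hφ
  -- a regular Haar measure on `𝔸_F` and its transport to `𝔸_E⁻`
  set μ : Measure (AdeleRing (𝓞 F) F) := Measure.addHaar with hμ
  set ν : Measure (traceZeroAdele F E c) := μ.map θ with hν
  haveI : ν.IsAddHaarMeasure := isAddHaarMeasure_map_traceZeroLine E c hcδ hδ μ
  haveI : ν.Regular := Regular.map θ.toHomeomorph
  -- a compact set of positive finite measure in `𝔸_F`
  obtain ⟨C, hC, hC0⟩ := exists_compact_mem_nhds (0 : AdeleRing (𝓞 F) F)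
  have hCpos : 0 < μ C := measure_pos_of_mem_nhds μ hC0
  have hCfin : μ C < ∞ := hC.measure_lt_top
  -- the module of `φ` computed on `X = θ(C)`
  have key := addEquivAddHaarChar_smul_preimage ν (X := θ '' C) φ
  have hpre : θ ⁻¹' (θ '' C) = C := θ.injective.preimage_image C
  rw [hν, map_traceZeroLine_apply, map_traceZeroLine_apply, ← hθ,
    preimage_traceZeroLine_preimage_smulTraceZero E c hcδ hδ, hpre,
    AdeleRing.addHaar_smul_eq_ideleNorm_mul F μ a⁻¹ C, map_inv] at key
  -- `χ * ‖a‖⁻¹ * μ C = μ C`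
  change traceZeroModulus _ _ = _
  have hχ : (traceZeroModulus (AdeleRing.ideleBaseChange F E a) (conjAdele_ideleBaseChange E c a) : ℝ≥0∞) *
      ((IdeleClassGroup.ideleNorm F a)⁻¹ : ℝ≥0) = 1 := by
    have h1 : ((traceZeroModulus (AdeleRing.ideleBaseChange F E a) (conjAdele_ideleBaseChange E c a) : ℝ≥0∞) *
        ((IdeleClassGroup.ideleNorm F a)⁻¹ : ℝ≥0)) * μ C = 1 * μ C := by
      rw [one_mul, mul_assoc]
      exact key
    exact (ENNReal.mul_left_inj hCpos.ne' hCfin.ne).1 h1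
  have hn0 : IdeleClassGroup.ideleNorm F a ≠ 0 :=
    ((Group.isUnit a).map (IdeleClassGroup.ideleNorm F)).ne_zero
  have h2 : ((traceZeroModulus (AdeleRing.ideleBaseChange F E a) (conjAdele_ideleBaseChange E c a) *
      (IdeleClassGroup.ideleNorm F a)⁻¹ : ℝ≥0) : ℝ≥0∞) = ((1 : ℝ≥0) : ℝ≥0∞) := by
    rw [ENNReal.coe_mul, ENNReal.coe_one]
    exact hχ
  have h3 : traceZeroModulus (AdeleRing.ideleBaseChange F E a) (conjAdele_ideleBaseChange E c a) *
      (IdeleClassGroup.ideleNorm F a)⁻¹ = 1 := ENNReal.coe_injective h2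
  rwa [mul_inv_eq_one₀ hn0] at h3

include hcδ hδ in
/-- The module dictionary for a `c`-fixed idele given directly: if `(c ⊗ 1) λ = λ` then
`traceZeroModulus λ = ‖a‖_{𝔸_F}` for the idele `a` of `F` with `a ⊗ 1 = λ`. [cite: CasselsFrohlichANT1967, Ch. XV Lemma 4.1.2] -/
theorem exists_traceZeroModulus_eq_ideleNorm (l : (AdeleRing (𝓞 E) E)ˣ) (hl : conjAdele F E c (l : AdeleRing (𝓞 E) E) = l) :
    ∃ a : (AdeleRing (𝓞 F) F)ˣ, AdeleRing.ideleBaseChange F E a = l ∧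
      traceZeroModulus l hl = IdeleClassGroup.ideleNorm F a := by
  obtain ⟨a, rfl⟩ := exists_ideleBaseChange_eq_of_conjAdele_eq E c hcδ hδ hl
  exact ⟨a, rfl, traceZeroModulus_ideleBaseChange E c hcδ hδ a⟩

end Modulus

end UnitaryGroup

end Literature.NumberTheory.Automorphic

end
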